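import Summits.BirchSwinnertonDyer.Uniform.U2.RingClassNoTwoTorsionPrelims
import Literature.NumberTheory.EllipticCurves.QuadraticTwistPadicReduction
import HarnessLib

/-!
# Track U2 (cell `bsd-uniform`, seat u2-p1): `E(F)[2] = 0` is twist-invariant over EVERY field of
# characteristic `0` — the `2`-division cubic under quadratic twists and changes of variables

HONEST FRAMING (cell `bsd-uniform`, HOME run/shared/lean/pub/bsd-uniform/): elementary algebra of
Weierstrass equations, no claim about BSD, nothing booked. Used by `TwistTamagawaTwoAdic.lean` (the
`2`-adic Tamagawa balance `hc` of the end-to-end heads as a class theorem) at `F = ℚ_q`: for a prime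
`q ∣ d` with `a_q` odd one has `E(ℚ_q)[2] = 0` (`TransportAOddTrace`), hence `E^{(d)}(ℚ_q)[2] = 0`
(this file), hence `c_q(E^{(d)})` is ODD (`LocalTwoTorsionOddIndex`). The tree's
`TransportA.torsionBy_two_eq_bot_of_twist` is the case `F = ℚ` (via the irreducibility of `ρ̄_{E,2}`);
here `F` is arbitrary of characteristic `0`, by a direct computation with the `2`-division cubic:

* §1 `forall_two_nsmul_eq_zero_iff_forall_ne`: for `V / F` elliptic, `V(F)[2] = 0` iff
  `4X³ + b₂X² + 2b₄X + b₆` has no root in `F` (Silverman AEC III.§1; the root `x` gives the point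
  `(x, −(a₁x + a₃)/2)`, `exists_two_nsmul_eq_zero_of_root`; the converse is
  `RingClass.mem_roots_of_two_nsmul_eq_zero`'s computation).
* §2 `cubic_smul` / `forall_cubic_ne_zero_iff_smul`: under `C = (u, r, s, t)` the cubic transforms
  by `x ↦ u²x + r` (Silverman III.1 Table 3.1); `cubic_quadraticTwist` /
  `forall_cubic_ne_zero_iff_quadraticTwist`: under the twist by `d` it transforms by `x ↦ d x`.
* §3 `forall_two_nsmul_eq_zero_iff_of_twist`: for `W / ℚ` elliptic, `d ≠ 0`, ANY model `W'` with
  `C • W' = W^{(d)}`, and any `F ⊇ ℚ` of characteristic `0`: `W(F)[2] = 0 ↔ W'(F)[2] = 0`.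

The `[DecidableEq F]` of Mathlib's group law is an instance ARGUMENT (as in the tree's
`pointGalHom`), so that the statements apply to `ℚ_[ℓ]` and to subfields of `ℂ` alike.

References: Silverman, AEC 2nd ed., III.§1 (2-division polynomial), III.1 Table 3.1, X.5 Cor. 5.4
[SilvermanAEC2009].
-/

noncomputable section

open scoped Classical

open WeierstrassCurve

set_option autoImplicit false

namespace Summit.BirchSwinnertonDyer.Uniform.U2.TwoTorsionField

variable {F : Type*} [Field F] [CharZero F] [DecidableEq F]

/-! ## §1 Over a field `F` of characteristic `0`: `V(F)[2] = 0` iff the `2`-division cubic has no root -/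

/-- A root `x ∈ F` of the `2`-division cubic `4X³ + b₂X² + 2b₄X + b₆` of an elliptic `V / F` is the
`x`-coordinate of the non-zero `2`-torsion point `(x, −(a₁x + a₃)/2)` (Silverman AEC III.§1).
[cite: SilvermanAEC2009, III.§1 (2-division polynomial)] -/
theorem exists_two_nsmul_eq_zero_of_root (V : WeierstrassCurve F) [V.IsElliptic] {x : F}
    (hx : 4 * x ^ 3 + V.b₂ * x ^ 2 + 2 * V.b₄ * x + V.b₆ = 0) :
    ∃ P : V.toAffine.Point, P ≠ 0 ∧ (2 : ℕ) • P = 0 := by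
  set y : F := -(V.a₁ * x + V.a₃) / 2 with hy
  have hψ : 2 * y + V.a₁ * x + V.a₃ = 0 := by rw [hy]; ring
  have heq : V.toAffine.Equation x y := by
    rw [Affine.equation_iff]
    simp only [WeierstrassCurve.b₂, WeierstrassCurve.b₄, WeierstrassCurve.b₆] at hx
    have h4 : (4 : F) * (y ^ 2 + V.a₁ * x * y + V.a₃ * y - (x ^ 3 + V.a₂ * x ^ 2 + V.a₄ * x + V.a₆)) =
        0 := by
      linear_combination (2 * y + V.a₁ * x + V.a₃) * hψ - hx
    have h4' : (4 : F) ≠ 0 := by norm_num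
    have := (mul_eq_zero.mp h4).resolve_left h4'
    linear_combination this
  have hns : V.toAffine.Nonsingular x y := (Affine.equation_iff_nonsingular).mp heq
  refine ⟨Affine.Point.some x y hns, Affine.Point.some_ne_zero hns, ?_⟩
  rw [two_nsmul, add_eq_zero_iff_eq_neg, Affine.Point.neg_some, Affine.Point.some.injEq]
  refine ⟨rfl, ?_⟩
  rw [Affine.negY]
  linear_combination hψ

/-- **`V(F)[2] = 0` iff the `2`-division cubic of `V` has no root in `F`** (`V / F` elliptic,
`char F = 0`). [cite: SilvermanAEC2009, III.§1 (2-division polynomial)] -/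
theorem forall_two_nsmul_eq_zero_iff_forall_ne (V : WeierstrassCurve F) [V.IsElliptic] :
    (∀ P : V.toAffine.Point, (2 : ℕ) • P = 0 → P = 0) ↔
      ∀ x : F, 4 * x ^ 3 + V.b₂ * x ^ 2 + 2 * V.b₄ * x + V.b₆ ≠ 0 := by
  constructor
  · intro h x hx
    obtain ⟨P, hP0, hP2⟩ := exists_two_nsmul_eq_zero_of_root V hx
    exact hP0 (h P hP2)
  · intro h P hP2
    rcases P with _ | ⟨x, y, hxy⟩
    · rfl
    · exfalso
      have hψ : 2 * y + V.a₁ * x + V.a₃ = 0 := by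
        rw [two_nsmul, add_eq_zero_iff_eq_neg, Affine.Point.neg_some, Affine.Point.some.injEq] at hP2
        have := hP2.2
        rw [Affine.negY] at this
        linear_combination this
      have heq := (Affine.equation_iff x y).mp hxy.1
      apply h x
      simp only [WeierstrassCurve.b₂, WeierstrassCurve.b₄, WeierstrassCurve.b₆]
      linear_combination (2 * y + V.a₁ * x + V.a₃) * hψ - 4 * heq

/-! ## §2 The cubic under changes of variables and quadratic twists -/

omit [CharZero F] [DecidableEq F] in
/-- The `2`-division cubic of `C • V` at `x` is `u⁻⁶` times that of `V` at `u²x + r`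
(Silverman AEC III.1 Table 3.1: `b₂' = u⁻²(b₂ + 12r)`, …). [cite: SilvermanAEC2009, III.1 Table 3.1] -/
theorem cubic_smul (V : WeierstrassCurve F) (C : VariableChange F) (x : F) :
    (C.u : F) ^ 6 * (4 * x ^ 3 + (C • V).b₂ * x ^ 2 + 2 * (C • V).b₄ * x + (C • V).b₆) =
      4 * ((C.u : F) ^ 2 * x + C.r) ^ 3 + V.b₂ * ((C.u : F) ^ 2 * x + C.r) ^ 2 +
        2 * V.b₄ * ((C.u : F) ^ 2 * x + C.r) + V.b₆ := by
  rw [variableChange_b₂, variableChange_b₄, variableChange_b₆]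
  simp only [Units.val_inv_eq_inv_val]
  have hu : (C.u : F) ≠ 0 := C.u.ne_zero
  field_simp
  ring

omit [CharZero F] [DecidableEq F] in
/-- Hence `C • V` has a rational `2`-division root iff `V` has (`x ↦ u²x + r`). [folklore] -/
theorem forall_cubic_ne_zero_iff_smul (V : WeierstrassCurve F) (C : VariableChange F) :
    (∀ x : F, 4 * x ^ 3 + (C • V).b₂ * x ^ 2 + 2 * (C • V).b₄ * x + (C • V).b₆ ≠ 0) ↔
      ∀ x : F, 4 * x ^ 3 + V.b₂ * x ^ 2 + 2 * V.b₄ * x + V.b₆ ≠ 0 := by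
  have hu : (C.u : F) ≠ 0 := C.u.ne_zero
  have hu6 : (C.u : F) ^ 6 ≠ 0 := pow_ne_zero 6 hu
  constructor
  · intro h x hx
    -- `x = u² x' + r` with `x' = u⁻² (x - r)`
    apply h (((C.u : F) ^ 2)⁻¹ * (x - C.r))
    have key := cubic_smul V C (((C.u : F) ^ 2)⁻¹ * (x - C.r))
    have hx' : (C.u : F) ^ 2 * (((C.u : F) ^ 2)⁻¹ * (x - C.r)) + C.r = x := by
      rw [← mul_assoc, mul_inv_cancel₀ (pow_ne_zero 2 hu), one_mul, sub_add_cancel]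
    rw [hx', hx] at key
    exact (mul_eq_zero.mp key).resolve_left hu6
  · intro h x hx
    apply h ((C.u : F) ^ 2 * x + C.r)
    rw [← cubic_smul V C x, hx, mul_zero]

omit [DecidableEq F] in
/-- The `2`-division cubic of the twist `V^{(d)}` at `d x` is `d³` times that of `V` at `x`
(`b₂(V^{(d)}) = d b₂`, `b₄(V^{(d)}) = d² b₄`, `b₆(V^{(d)}) = d³ b₆`). [folklore] -/
theorem cubic_quadraticTwist (V : WeierstrassCurve F) (d x : F) :
    4 * (d * x) ^ 3 + (V.quadraticTwist d).b₂ * (d * x) ^ 2 + 2 * (V.quadraticTwist d).b₄ * (d * x) +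
        (V.quadraticTwist d).b₆ =
      d ^ 3 * (4 * x ^ 3 + V.b₂ * x ^ 2 + 2 * V.b₄ * x + V.b₆) := by
  rw [quadraticTwist_b₂, quadraticTwist_b₄, quadraticTwist_b₆]
  ring

omit [DecidableEq F] in
/-- Hence `V^{(d)}` (`d ≠ 0`) has a rational `2`-division root iff `V` has (`x ↦ d x`). [folklore] -/
theorem forall_cubic_ne_zero_iff_quadraticTwist (V : WeierstrassCurve F) {d : F} (hd : d ≠ 0) :
    (∀ x : F, 4 * x ^ 3 + (V.quadraticTwist d).b₂ * x ^ 2 + 2 * (V.quadraticTwist d).b₄ * x +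
        (V.quadraticTwist d).b₆ ≠ 0) ↔
      ∀ x : F, 4 * x ^ 3 + V.b₂ * x ^ 2 + 2 * V.b₄ * x + V.b₆ ≠ 0 := by
  have hd3 : d ^ 3 ≠ 0 := pow_ne_zero 3 hd
  constructor
  · intro h x hx
    apply h (d * x)
    rw [cubic_quadraticTwist, hx, mul_zero]
  · intro h x hx
    apply h (d⁻¹ * x)
    have key := cubic_quadraticTwist V d (d⁻¹ * x)
    rw [← mul_assoc, mul_inv_cancel₀ hd, one_mul, hx] at key
    exact (mul_eq_zero.mp key.symm).resolve_left hd3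

/-! ## §3 `E(F)[2] = 0` is twist-invariant, for every field `F ⊇ ℚ` -/

/-- **`E(F)[2] = 0 ⟺ E^{(d)}(F)[2] = 0`, any model, any field of characteristic `0`.** For `W / ℚ`
elliptic, `d ≠ 0` and any model `W'` of the twist (`C • W' = W^{(d)}`), and any field `F` of
characteristic `0` (e.g. `ℚ_ℓ`, a number field): `W(F)[2] = 0 ↔ W'(F)[2] = 0` — the
`x`-coordinates of the non-zero `2`-torsion points are the roots of the `2`-division cubic, which
correspond under `x ↦ d x` (twist) and `x ↦ u²x + r` (change of variables).
[cite: SilvermanAEC2009, III.§1 and X.5 Cor. 5.4] -/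
theorem forall_two_nsmul_eq_zero_iff_of_twist (W : WeierstrassCurve ℚ) [W.IsElliptic] {d : ℚ}
    (hd : d ≠ 0) (W' : WeierstrassCurve ℚ) [W'.IsElliptic]
    (htw : ∃ C : VariableChange ℚ, C • W' = W.quadraticTwist d) :
    (∀ P : (W.baseChange F).toAffine.Point, (2 : ℕ) • P = 0 → P = 0) ↔
      ∀ P : (W'.baseChange F).toAffine.Point, (2 : ℕ) • P = 0 → P = 0 := by
  obtain ⟨C, hC⟩ := htw
  haveI : (W.baseChange F).IsElliptic := inferInstanceAs (W.map (algebraMap ℚ F)).IsElliptic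
  haveI : (W'.baseChange F).IsElliptic := inferInstanceAs (W'.map (algebraMap ℚ F)).IsElliptic
  have hdF : (algebraMap ℚ F d) ≠ 0 := by rw [Ne, map_eq_zero]; exact hd
  -- `W' ⊗ F = (C⁻¹ ⊗ F) • (W ⊗ F)^{(d)}`
  have hW' : W'.baseChange F =
      (C⁻¹.map (algebraMap ℚ F)) • (W.baseChange F).quadraticTwist (algebraMap ℚ F d) := by
    have h1 : W' = C⁻¹ • W.quadraticTwist d := by rw [← hC, inv_smul_smul]
    rw [h1, WeierstrassCurve.baseChange, ← WeierstrassCurve.map_variableChange, map_quadraticTwist]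
    rfl
  rw [forall_two_nsmul_eq_zero_iff_forall_ne (W.baseChange F),
    forall_two_nsmul_eq_zero_iff_forall_ne (W'.baseChange F), hW',
    forall_cubic_ne_zero_iff_smul, forall_cubic_ne_zero_iff_quadraticTwist _ hdF]

end Summit.BirchSwinnertonDyer.Uniform.U2.TwoTorsionField

end
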